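import Summits.AtomisticToContinuum.Crystallization.Theorems.ChartedZeroExcessLayeredLatticeLiouvilleYFA

/-!
# Charted zero-excess layered-lattice Liouville — YF «EnclosureCut» — part 2 of 2 (sequel of `…ChartedZeroExcessLayeredLatticeLiouvilleYFA`)

Split for the 400-line cap of the landing lane; the module docstring of part 1 (`…ChartedZeroExcessLayeredLatticeLiouvilleYFA`) describes the whole node.  Same
namespace; contents: YF-3 the residual counts and leaves [SSHSᵇ] `SlenderSereneHotSparseBPG` / [BSHSᵇ] `BuriedSereneHotSparseBPG`, the pointwise cut under the
door [CMC] and the glue `[SBHSᵇ] ⟸ [CMC] ∧ [SSHSᵇ] ∧ [BSHSᵇ]` (PROVED) with the WEAKER certificates; YF-4 the (E1) kit `CleanClassHotGapKit` (ASIDE) and its proved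
bulk pricing; YF-5 the column `gap_and_pert_1_50_of_certs_16XH24B`.
0 sorry; standard axioms; no instances / notations / option overrides.
-/

noncomputable section

open scoped BigOperators Classical
open MeasureTheory Set Metric Filter Topology
open Summit.AtomisticToContinuum.Crystallization.Theorems.ChartedPlanarOrderRigidityDoor (E3 eStar atomsIn IsEStarGSC siteEnergy VisibleGap PertRegime)
open Summit.AtomisticToContinuum.Crystallization.Theorems.ChartedPlanarOrderDensityDichotomy (μS IsSep nK nK_nonneg)
open Summit.AtomisticToContinuum.Crystallization.Theorems.ChartedPlanarOrderCleanScaleP (IsCleanP IsDoorSetP)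
open Summit.AtomisticToContinuum.Crystallization.Theorems.ChartedPlanarOrderMesoCut (LayeredHom EnvClose)
open Summit.AtomisticToContinuum.Crystallization.Theorems.ChartedPlanarOrderDoorLayered (atomsIn_subset sq_le_finsum_mem PeriodicBulkGapDoor)
open Summit.AtomisticToContinuum.Crystallization.Theorems.ChartedPlanarOrderDoorLayeredOsc (IsTwoShellAffineGood)
open Literature.MathematicalPhysics.StatisticalMechanics (card_le_of_separated_of_dist_le lennardJones)

namespace Summit.AtomisticToContinuum.Crystallization.Theorems.ChartedZeroExcessLayeredLatticeLiouville

/-! ### YF-3  The residual counts (linked classes), the leaves [SSHSᵇ], [BSHSᵇ], the glue `[SBHSᵇ] ⟸ [CMC] ∧ [SSHSᵇ] ∧ [BSHSᵇ]`, certificates -/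

/-- number of SLENDER serene bare hot sites of `Q`: bare, hot, serene, LINKED (not `(q, D)`-isolated) and NOT `b`-buried. [this file, g63] -/
def slenderSereneHotCount (ϑc ϑ r ra ϑe ωe : ℝ) (p : ℕ) (r₀ ℓ : ℝ) (M : ℕ) (q D b : ℝ) (S H Q : Set E3) : ℝ :=
  ∑ᶠ x ∈ Q, if ¬ IsDressed ϑe ωe p r₀ ℓ M S H x ∧ ¬ IsTameStar ϑ S H x ∧ ¬ IsAgitated ϑc ϑ r ra S H x ∧ ¬ IsHotIsolated ϑ q D S H x ∧ ¬ IsBuried ϑ b S H x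
    then (1 : ℝ) else 0

/-- number of BURIED serene bare hot sites of `Q`: bare, hot, serene and `b`-buried. [this file, g63] -/
def buriedSereneHotCount (ϑc ϑ r ra ϑe ωe : ℝ) (p : ℕ) (r₀ ℓ : ℝ) (M : ℕ) (b : ℝ) (S H Q : Set E3) : ℝ :=
  ∑ᶠ x ∈ Q, if ¬ IsDressed ϑe ωe p r₀ ℓ M S H x ∧ ¬ IsTameStar ϑ S H x ∧ ¬ IsAgitated ϑc ϑ r ra S H x ∧ IsBuried ϑ b S H x then (1 : ℝ) else 0

/-- `slenderSereneHotCount_nonneg`. [formal bookkeeping] -/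
theorem slenderSereneHotCount_nonneg (ϑc ϑ r ra ϑe ωe : ℝ) (p : ℕ) (r₀ ℓ : ℝ) (M : ℕ) (q D b : ℝ) (S H Q : Set E3) :
    0 ≤ slenderSereneHotCount ϑc ϑ r ra ϑe ωe p r₀ ℓ M q D b S H Q :=
  finsum_nonneg fun x => finsum_nonneg fun _ => by split_ifs <;> norm_num

/-- `buriedSereneHotCount_nonneg`. [formal bookkeeping] -/
theorem buriedSereneHotCount_nonneg (ϑc ϑ r ra ϑe ωe : ℝ) (p : ℕ) (r₀ ℓ : ℝ) (M : ℕ) (b : ℝ) (S H Q : Set E3) :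
    0 ≤ buriedSereneHotCount ϑc ϑ r ra ϑe ωe p r₀ ℓ M b S H Q :=
  finsum_nonneg fun x => finsum_nonneg fun _ => by split_ifs <;> norm_num

/-- `buriedSereneHotCount` is monotone in the window. [formal bookkeeping] -/
theorem buriedSereneHotCount_mono {ϑc ϑ r ra ϑe ωe : ℝ} {p : ℕ} {r₀ ℓ : ℝ} {M : ℕ} {b : ℝ} {S H Q Q' : Set E3} (hQ' : Q'.Finite) (h : Q ⊆ Q') :
    buriedSereneHotCount ϑc ϑ r ra ϑe ωe p r₀ ℓ M b S H Q ≤ buriedSereneHotCount ϑc ϑ r ra ϑe ωe p r₀ ℓ M b S H Q' :=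
  finsum_mem_le_finsum_mem_of_subset_of_nonneg hQ' h fun x _ => by split_ifs <;> norm_num

/-- sub-count (PROVED): slender ⊆ serene bare hot. [this file, g63] -/
theorem slenderSereneHotCount_le_serene {ϑc ϑ r ra ϑe ωe : ℝ} {p : ℕ} {r₀ ℓ : ℝ} {M : ℕ} {q D b : ℝ} {S H Q : Set E3} (hQ : Q.Finite) :
    slenderSereneHotCount ϑc ϑ r ra ϑe ωe p r₀ ℓ M q D b S H Q ≤ sereneBareHotCount ϑc ϑ r ra ϑe ωe p r₀ ℓ M S H Q := by
  rw [slenderSereneHotCount, sereneBareHotCount, finsum_mem_eq_finite_toFinset_sum _ hQ, finsum_mem_eq_finite_toFinset_sum _ hQ]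
  refine Finset.sum_le_sum fun x _ => ?_
  by_cases hd : IsDressed ϑe ωe p r₀ ℓ M S H x ∨ IsTameStar ϑ S H x ∨ IsAgitated ϑc ϑ r ra S H x
  · rw [if_pos hd, if_neg (fun h' => h'.1 (hd.elim id fun h₂ => h₂.elim (fun h₃ => absurd h₃ h'.2.1) fun h₄ => absurd h₄ h'.2.2.1))]
  · rw [if_neg hd]
    split_ifs <;> norm_num

/-- sub-count (PROVED): buried ⊆ serene bare hot. [this file, g63] -/
theorem buriedSereneHotCount_le_serene {ϑc ϑ r ra ϑe ωe : ℝ} {p : ℕ} {r₀ ℓ : ℝ} {M : ℕ} {b : ℝ} {S H Q : Set E3} (hQ : Q.Finite) :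
    buriedSereneHotCount ϑc ϑ r ra ϑe ωe p r₀ ℓ M b S H Q ≤ sereneBareHotCount ϑc ϑ r ra ϑe ωe p r₀ ℓ M S H Q := by
  rw [buriedSereneHotCount, sereneBareHotCount, finsum_mem_eq_finite_toFinset_sum _ hQ, finsum_mem_eq_finite_toFinset_sum _ hQ]
  refine Finset.sum_le_sum fun x _ => ?_
  by_cases hd : IsDressed ϑe ωe p r₀ ℓ M S H x ∨ IsTameStar ϑ S H x ∨ IsAgitated ϑc ϑ r ra S H x
  · rw [if_pos hd, if_neg (fun h' => h'.1 (hd.elim id fun h₂ => h₂.elim (fun h₃ => absurd h₃ h'.2.1) fun h₄ => absurd h₄ h'.2.2.1))]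
  · rw [if_neg hd]
    split_ifs <;> norm_num

/-- ★★ **THE POINTWISE CUT UNDER THE DOOR (PROVED)**: on a finite chunk `Q ⊆ S` of a θ-good e⋆-GSC door set with an equilibrium chart, under [CMC] and the side
conditions, `sereneBareHotCount ≤ slenderSereneHotCount + buriedSereneHotCount` — a serene bare hot site is linked (sitewise exclusion), then buried or slender. -/
theorem sereneBareHotCount_le_slender_add_buried_of_coolMoatCore {ϑc ϑ r ra ϑe ωe : ℝ} {p : ℕ} {r₀ ℓ : ℝ} {M : ℕ} {q rsh D b aHi Λ θ s : ℝ}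
    (hq : 0 ≤ q) (hra : r + rsh + q ≤ ra) (hD : 2 * r + rsh + q ≤ D) (hC : CoolMoatCorePG ϑc ϑ r q rsh aHi Λ θ s) {δ : ℝ} (hδ : 0 < δ) {a : ℝ}
    (ha : 0 < a) {S : Set E3} (hS : IsDoorSetPG aHi δ S) (hgood : ∀ p' ∈ S, IsTwoShellAffineGood θ S p') {L : E3 ≃L[ℝ] E3} {w : ℤ → E3}
    (hLw : IsEquilChart a s Λ L w) {Q : Set E3} (hQ : Q.Finite) (hQS : Q ⊆ S) :
    sereneBareHotCount ϑc ϑ r ra ϑe ωe p r₀ ℓ M S (LayeredHom (L : E3 →L[ℝ] E3) w) Q ≤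
      slenderSereneHotCount ϑc ϑ r ra ϑe ωe p r₀ ℓ M q D b S (LayeredHom (L : E3 →L[ℝ] E3) w) Q +
        buriedSereneHotCount ϑc ϑ r ra ϑe ωe p r₀ ℓ M b S (LayeredHom (L : E3 →L[ℝ] E3) w) Q := by
  rw [sereneBareHotCount, slenderSereneHotCount, buriedSereneHotCount, finsum_mem_eq_finite_toFinset_sum _ hQ, finsum_mem_eq_finite_toFinset_sum _ hQ,
    finsum_mem_eq_finite_toFinset_sum _ hQ, ← Finset.sum_add_distrib]
  refine Finset.sum_le_sum fun x hx => ?_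
  have hxS : x ∈ S := hQS (hQ.mem_toFinset.1 hx)
  by_cases hd : IsDressed ϑe ωe p r₀ ℓ M S (LayeredHom (L : E3 →L[ℝ] E3) w) x ∨ IsTameStar ϑ S (LayeredHom (L : E3 →L[ℝ] E3) w) x ∨
      IsAgitated ϑc ϑ r ra S (LayeredHom (L : E3 →L[ℝ] E3) w) x
  · rw [if_pos hd]
    exact add_nonneg (by split_ifs <;> norm_num) (by split_ifs <;> norm_num)
  · rw [if_neg hd]
    have hnd : ¬ IsDressed ϑe ωe p r₀ ℓ M S (LayeredHom (L : E3 →L[ℝ] E3) w) x := fun h' => hd (Or.inl h')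
    have hnt : ¬ IsTameStar ϑ S (LayeredHom (L : E3 →L[ℝ] E3) w) x := fun h' => hd (Or.inr (Or.inl h'))
    have hna : ¬ IsAgitated ϑc ϑ r ra S (LayeredHom (L : E3 →L[ℝ] E3) w) x := fun h' => hd (Or.inr (Or.inr h'))
    have hni : ¬ IsHotIsolated ϑ q D S (LayeredHom (L : E3 →L[ℝ] E3) w) x :=
      not_hot_serene_isolated_of_coolMoatCore hq hra hD hC hδ ha hS hgood hLw hxS hnt hna
    by_cases hb : IsBuried ϑ b S (LayeredHom (L : E3 →L[ℝ] E3) w) x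
    · simp [hnd, hnt, hna, hni, hb]
    · simp [hnd, hnt, hna, hni, hb]

/-- ★★ **[SSHSᵇ] «SlenderSereneHotSparseBPG ϑc ϑ r ra ϑe ωe p r₀ ℓ M q D b aHi Λ θ s» — SLENDER SERENE BARE HOT SITES ARE `o(η)`-SPARSE** (generic class 1 of the
cut): with the B-body's binders, the sites of `win R` that are bare, `ϑ`-hot, serene at radius `ra`, LINKED (a hot site at distance `∈ (q, D]`) and NOT `b`-buried
(a tame site within `b`) number `≤ εw·η·nK(win R)`.  WEAKER than [SBHSᵇ] (sub-count, PROVED).  Inhabitants: thin or extended serene hot networks — filaments,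
sheets, rinds of lumps (within `b` of their surface) — whose far field is screened (serene).  MECHANISM (IDEA-NAMED, part YE (E1)–(E3) minus the compact case):
FEATHERED EXCISION of a filament / sheet segment by the chart inside a collar, gain `≥ c·ϑ²·#segment` against cut-END / RIM costs `O(1)` per cut and ambient
coupling `≤ C·ϑc·ϑ·#segment` — so segments longer than `C'/(c·ϑ² − C·ϑc·ϑ)` are GSC-removable; the residual is then networks of bounded segment length, i.e.
junction-dense, which cleanliness should forbid.  NEW · GSC-priced · UNDECIDED · IDEA-NAMED · INSTRUMENTABLE («SereneScan» + linking statistics: per serene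
bare hot site, the distances to the nearest hot site beyond `q` and to the nearest tame site; prediction in relaxed defected windows: class EMPTY).
Why it might fail: a serene clean hot SHEET (stacking-fault-like elastic lamella with `5–6 %` shear confined by cool surroundings) of extent `≍ η`-density —
sheets have no cut-end cost per unit area small enough; none known for Lennard-Jones in the charted clean class (SHEET24 of the census is dressed, not bare).
Sources: part YE ([SBHSᵇ], (E1)–(E3)); part UG (dressing); Theil 2006; Flatley–Theil 2015 (arXiv 1407.0692); Braun–Hudson–Ortner arXiv 2108.04765. [this file, g63] -/
def SlenderSereneHotSparseBPG (ϑc ϑ r ra ϑe ωe : ℝ) (p : ℕ) (r₀ ℓ : ℝ) (M : ℕ) (q D b aHi Λ θ s : ℝ) : Prop :=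
  CountSparseBPG (fun S H _ Q => slenderSereneHotCount ϑc ϑ r ra ϑe ωe p r₀ ℓ M q D b S H Q) aHi Λ θ s

/-- ★★ **[BSHSᵇ] «BuriedSereneHotSparseBPG ϑc ϑ r ra ϑe ωe p r₀ ℓ M b aHi Λ θ s» — BURIED SERENE BARE HOT SITES ARE `o(η)`-SPARSE** (generic class 2, the
«BuriedFatLump» residual of row 1181): with the B-body's binders, the sites of `win R` that are bare, `ϑ`-hot, serene and `b`-BURIED (every site within `b` is
hot) number `≤ εw·η·nK(win R)`.  WEAKER than [SBHSᵇ] (sub-count, PROVED).  Inhabitants: interiors (depth `≥ b`) of FAT clean hot lumps — the inhabitant SHARED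
with [TBISᵇ(8)] (whose far-warm halos such lumps produce, (c3)); by [CMC] such a lump is never isolated-and-cool-moated, so it is agitated on its rind and
silent only in its depth.  MECHANISM: volume-vs-surface excision with a strained tame patch — gain `≥ c·ϑ²·V` against rind cost `≲ C·σ_rind·V^{2/3}` and
ambient `C·σ_amb²·V`, decisive when `σ_amb < ϑ·√(c/C)`; the arbitrary-volume enclosure lemma («cool far boundary ⇒ tame interior», a discrete De Giorgi /
small-data-uniqueness statement at ALL scales) would empty the class.  NEW · GSC-priced · UNDECIDED · IDEA-NEEDED (arbitrary-volume enclosure) · INSTRUMENTABLE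
(«SereneScan»: do fat clean `1/20`-hot lumps occur at all in relaxed e⋆-windows? prediction: none — a `5 %`-strained defect-free inclusion needs a source).
Why it might fail: a stress-stabilised competing clean phase / coherently strained inclusion at `5 %` strain occupying volume fraction `≍ η`; none for
Lennard-Jones pair potentials (fcc/hcp only), but no theorem excludes it.
Sources: part YE ([SBHSᵇ] residual inhabitant); part UH (clamped currency); E–Ming 2007; Ortner–Theil 2013; CRITIC-LEDGER row 1181 (honest placement). [this file, g63] -/
def BuriedSereneHotSparseBPG (ϑc ϑ r ra ϑe ωe : ℝ) (p : ℕ) (r₀ ℓ : ℝ) (M : ℕ) (b aHi Λ θ s : ℝ) : Prop :=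
  CountSparseBPG (fun S H _ Q => buriedSereneHotCount ϑc ϑ r ra ϑe ωe p r₀ ℓ M b S H Q) aHi Λ θ s

/-- **[SBHSᵇ] ⇒ [SSHSᵇ] (PROVED)** — WEAKER (sub-count). [this file, g63] -/
theorem slenderSereneHotSparseBPG_of_serene {ϑc ϑ r ra ϑe ωe : ℝ} {p : ℕ} {r₀ ℓ : ℝ} {M : ℕ} {q D b aHi Λ θ s : ℝ}
    (h : SereneBareHotSparseBPG ϑc ϑ r ra ϑe ωe p r₀ ℓ M aHi Λ θ s) : SlenderSereneHotSparseBPG ϑc ϑ r ra ϑe ωe p r₀ ℓ M q D b aHi Λ θ s :=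
  CountSparseBPG.of_pointwise_le (fun _ _ _ _ hQ _ _ => slenderSereneHotCount_le_serene hQ) h

/-- **[SBHSᵇ] ⇒ [BSHSᵇ] (PROVED)** — WEAKER (sub-count). [this file, g63] -/
theorem buriedSereneHotSparseBPG_of_serene {ϑc ϑ r ra ϑe ωe : ℝ} {p : ℕ} {r₀ ℓ : ℝ} {M : ℕ} {b aHi Λ θ s : ℝ}
    (h : SereneBareHotSparseBPG ϑc ϑ r ra ϑe ωe p r₀ ℓ M aHi Λ θ s) : BuriedSereneHotSparseBPG ϑc ϑ r ra ϑe ωe p r₀ ℓ M b aHi Λ θ s :=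
  CountSparseBPG.of_pointwise_le (fun _ _ _ _ hQ _ _ => buriedSereneHotCount_le_serene hQ) h

/-- ★★★ **GLUE (PROVED): [CMC] ∧ [SSHSᵇ] ∧ [BSHSᵇ] ⇒ [SBHSᵇ]** (`aHi ≤ 8/7`, `0 ≤ q`, `ra ≥ r + rsh + q`, `D ≥ 2r + rsh + q`): the two residual leaves sum
(`CountSparseBPG.of_le_add`), and under the door the serene bare hot count is below that sum on every window (the isolated class is empty). [this file, g63] -/
theorem sereneBareHotSparseBPG_of_coolMoat_slender_buried {ϑc ϑ r ra ϑe ωe : ℝ} {p : ℕ} {r₀ ℓ : ℝ} {M : ℕ} {q rsh D b aHi Λ θ s : ℝ}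
    (haHi : aHi ≤ 8 / 7) (hq : 0 ≤ q) (hra : r + rsh + q ≤ ra) (hD : 2 * r + rsh + q ≤ D) (hC : CoolMoatCorePG ϑc ϑ r q rsh aHi Λ θ s)
    (hSl : SlenderSereneHotSparseBPG ϑc ϑ r ra ϑe ωe p r₀ ℓ M q D b aHi Λ θ s) (hBu : BuriedSereneHotSparseBPG ϑc ϑ r ra ϑe ωe p r₀ ℓ M b aHi Λ θ s) :
    SereneBareHotSparseBPG ϑc ϑ r ra ϑe ωe p r₀ ℓ M aHi Λ θ s := by
  have hsum : CountSparseBPG (fun S H _ Q => slenderSereneHotCount ϑc ϑ r ra ϑe ωe p r₀ ℓ M q D b S H Q +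
      buriedSereneHotCount ϑc ϑ r ra ϑe ωe p r₀ ℓ M b S H Q) aHi Λ θ s :=
    CountSparseBPG.of_le_add (cntB := fun S H _ Q => slenderSereneHotCount ϑc ϑ r ra ϑe ωe p r₀ ℓ M q D b S H Q)
      (cntC := fun S H _ Q => buriedSereneHotCount ϑc ϑ r ra ϑe ωe p r₀ ℓ M b S H Q) haHi (fun _ _ _ _ _ _ _ => le_rfl)
      (fun _ _ _ _ _ hQ' hQQ' => buriedSereneHotCount_mono hQ' hQQ') hSl hBu
  intro δ hδ a ha Cg hCg εw hεw K₀ hK₀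
  obtain ⟨η₁, hη₁, R₁, hR₁, h1⟩ := hsum δ hδ a ha Cg hCg εw hεw K₀ hK₀
  refine ⟨η₁, hη₁, R₁, hR₁, fun S hS hgood η hη hηle R hR L w hLw Ψ hΨ hBI hfat => ?_⟩
  exact (sereneBareHotCount_le_slender_add_buried_of_coolMoatCore hq hra hD hC hδ ha hS hgood hLw (finite_atomsIn hδ hS.1.2.1 R) (atomsIn_subset S R)).trans
    (h1 S hS hgood η hη hηle R hR L w hLw Ψ hΨ hBI hfat)

/-- **THE SERENE LEAF OF RECORD ⇒ THE TWO RESIDUALS AT THE LARGER RADIUS (PROVED)**: [SBHSᵇ](ra) ⇒ [SSHSᵇ](ra') ∧ [BSHSᵇ](ra') for `ra ≤ ra'` — every residual of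
the new docket is WEAKER than the leaf it replaces; only the door [CMC] is new. [this file, g63] -/
theorem slender_and_buried_of_serene {ϑc ϑ r ra ra' ϑe ωe : ℝ} {p : ℕ} {r₀ ℓ : ℝ} {M : ℕ} {q D b aHi Λ θ s : ℝ} (h : ra ≤ ra')
    (hS : SereneBareHotSparseBPG ϑc ϑ r ra ϑe ωe p r₀ ℓ M aHi Λ θ s) :
    SlenderSereneHotSparseBPG ϑc ϑ r ra' ϑe ωe p r₀ ℓ M q D b aHi Λ θ s ∧ BuriedSereneHotSparseBPG ϑc ϑ r ra' ϑe ωe p r₀ ℓ M b aHi Λ θ s :=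
  ⟨slenderSereneHotSparseBPG_of_serene (hS.of_ra_le h), buriedSereneHotSparseBPG_of_serene (hS.of_ra_le h)⟩

/-! ### YF-4  (E1) the clean-class hot-gap KIT (row 1181 (c1)) and its proved bulk pricing — ASIDE, sub-mechanism (K2b) of [CMCᶜ] -/

/-- number of INTRINSICALLY `ϑ`-hot sites of `Q`: not `ϑ`-tame for ANY equilibrium `s`-chart about scale `a` (stacking-blind hotness). [this file, g63] -/
def wildHotCount (ϑ a s Λ : ℝ) (S Q : Set E3) : ℝ :=
  ∑ᶠ x ∈ Q, if (∃ (L : E3 ≃L[ℝ] E3) (w : ℤ → E3), IsEquilChart a s Λ L w ∧ IsTameStar ϑ S (LayeredHom (L : E3 →L[ℝ] E3) w) x) then (0 : ℝ) else 1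

/-- an intrinsically hot site is hot for the given equilibrium chart (PROVED): `wildHotCount ≤ hotCount`. [this file, g63] -/
theorem wildHotCount_le_hotCount {ϑ a s Λ : ℝ} {S Q : Set E3} (hQ : Q.Finite) {L : E3 ≃L[ℝ] E3} {w : ℤ → E3} (hLw : IsEquilChart a s Λ L w) :
    wildHotCount ϑ a s Λ S Q ≤ hotCount ϑ S (LayeredHom (L : E3 →L[ℝ] E3) w) Q := by
  rw [wildHotCount, hotCount, finsum_mem_eq_finite_toFinset_sum _ hQ, finsum_mem_eq_finite_toFinset_sum _ hQ]
  refine Finset.sum_le_sum fun x _ => ?_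
  by_cases ht : IsTameStar ϑ S (LayeredHom (L : E3 →L[ℝ] E3) w) x
  · rw [if_pos ht, if_pos ⟨L, w, hLw, ht⟩]
  · rw [if_neg ht]
    split_ifs <;> norm_num

/-- ★★ **(E1) «CleanClassHotGapKit c ϑ rc a s Λ aHi θ» — THE NULL-LAGRANGIAN-CORRECTED CELL EXCESS AS A FINITE-CERTIFICATE KIT** (row 1181 (c1)).  There are a
CELL FUNCTIONAL `cell S x` and a bookkeeping constant `Cbk ≥ 0` with: (LOCAL) `cell S x` depends only on `S ∩ B̄(x, rc)` — a function of finitely many points on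
separated sets, hence certifiable by interval arithmetic per stacking word; (FLOOR) `cell S x ≥ 0` at every site of a θ-good `aHi`-door set (`IsDoorSetP`, no GSC);
(GAP) `cell S x ≥ c·ϑ²` at every INTRINSICALLY `ϑ`-hot site (hot for every equilibrium `s`-chart about `a` — stacking-blind, so the `≈ 10⁻⁴·ε` fcc/hcp cell
degeneracy is not in the way); (BOOK) on every finite chunk `C ⊆ S` of a door set with summable pair sums, `Σ_{x ∈ C} cell S x ≤ Σ_{x ∈ C} (e_x − e⋆) +
Cbk·#{x ∈ C : some site of S ∖ C within rc}` (tree `siteEnergy`: the discrete null Lagrangian telescopes to the `rc`-boundary layer; the `r⁻⁶` tails beyond `rc`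
are booked into `cell` at their bulk value, fluctuation `≲ 3ϑ·10⁻³ ≪ c·ϑ²` at `rc = 8`).  PROVED consequence: `wildHotCount_priced_of_kit`.  The (K2b) input of
[CMCᶜ] (with (K0) it prices chart-hot sites); NOT in the cone of `_16XH24B` (ASIDE).  TYPED · FINITE · UNDECIDED · INSTRUMENTABLE («HotCellGapScan»: minimise a
candidate `cell` — two-shell Lennard-Jones cell energy minus the affine Taylor part at the relaxed Barlow cell of the word, tails booked — over the clean annulus
`1/20 ≤ star misfit ≤ 1/16` per stacking word of length `≤` the door's; report `min cell / ϑ²` and the FLOOR margin on tame clean cells; lens-5 two-shell cell kit)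
· BARRIER-ADJACENT (`Literature.Barriers.AtomisticToContinuum.LocalizedPotentialsExcludeLennardJones`: the cellwise-positivity classes of Theil 2006 /
Flatley–Theil 2015 exclude `V_LJ`; the kit asks positivity only on the CHARTED `1/16`-clean class with a boundary-booked null Lagrangian — outside the printed
classes, inside their technique; the bet is the finite computation).
Why it might fail: the per-site corrected quadratic form of `V_LJ` is INDEFINITE (negative transverse stiffness of the compressed nearest-neighbour bonds,
`V'(a₀) < 0`, and concave second shell), so FLOOR may need cells larger than two shells or fail for every local `cell` — positivity of the lattice Hessian is a
SUM property (E–Ming), not a cell property.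
Sources: Theil, Comm. Math. Phys. 262 (2006) 209; Flatley–Theil, Arch. Ration. Mech. Anal. 218 (2015) 363; E–Ming 2007; the Barrier file above; part YE (E1);
CRITIC-LEDGER row 1181 (c1). [this file, g63] -/
def CleanClassHotGapKit (c ϑ rc a s Λ aHi θ : ℝ) : Prop :=
  ∃ cell : Set E3 → E3 → ℝ, ∃ Cbk : ℝ, 0 ≤ Cbk ∧
    (∀ (S S' : Set E3) (x : E3), S ∩ closedBall x rc = S' ∩ closedBall x rc → cell S x = cell S' x) ∧
    (∀ δ : ℝ, 0 < δ → ∀ S : Set E3, IsDoorSetP aHi δ S → (∀ p ∈ S, IsTwoShellAffineGood θ S p) → ∀ x ∈ S, 0 ≤ cell S x) ∧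
    (∀ δ : ℝ, 0 < δ → ∀ S : Set E3, IsDoorSetP aHi δ S → (∀ p ∈ S, IsTwoShellAffineGood θ S p) → ∀ x ∈ S,
      (∀ (L : E3 ≃L[ℝ] E3) (w : ℤ → E3), IsEquilChart a s Λ L w → ¬ IsTameStar ϑ S (LayeredHom (L : E3 →L[ℝ] E3) w) x) → c * ϑ ^ 2 ≤ cell S x) ∧
    (∀ δ : ℝ, 0 < δ → ∀ S : Set E3, IsDoorSetP aHi δ S → (∀ p ∈ S, IsTwoShellAffineGood θ S p) →
      (∀ z : E3, Summable fun y : S => lennardJones (dist z (y : E3))) → ∀ C : Set E3, C ⊆ S → C.Finite →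
        ∑ᶠ x ∈ C, cell S x ≤ ∑ᶠ x ∈ C, (siteEnergy (μS S) x - eStar) + Cbk * (({x ∈ C | ∃ y ∈ S \ C, dist y x ≤ rc}).ncard : ℝ))

/-- ★★ **BULK PRICING OF HOT SITES FROM THE KIT (PROVED)**: `c·ϑ²·wildHotCount(C) ≤ Σ_{x ∈ C} (e_x − e⋆) + Cbk·#∂_{rc} C` on every finite chunk of a θ-good door set
with summable pair sums — intrinsically hot sites cost bulk energy, payable only by excess site energy or through the boundary layer. [this file, g63] -/
theorem wildHotCount_priced_of_kit {c ϑ rc a s Λ aHi θ : ℝ} (hk : CleanClassHotGapKit c ϑ rc a s Λ aHi θ) :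
    ∃ Cbk : ℝ, 0 ≤ Cbk ∧ ∀ δ : ℝ, 0 < δ → ∀ S : Set E3, IsDoorSetP aHi δ S → (∀ p ∈ S, IsTwoShellAffineGood θ S p) →
      (∀ z : E3, Summable fun y : S => lennardJones (dist z (y : E3))) → ∀ C : Set E3, C ⊆ S → C.Finite →
        c * ϑ ^ 2 * wildHotCount ϑ a s Λ S C ≤ ∑ᶠ x ∈ C, (siteEnergy (μS S) x - eStar) + Cbk * (({x ∈ C | ∃ y ∈ S \ C, dist y x ≤ rc}).ncard : ℝ) := by
  obtain ⟨cell, Cbk, hCbk, -, hfloor, hgap, hbook⟩ := hk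
  refine ⟨Cbk, hCbk, fun δ hδ S hS hgood hsum C hCS hCf => ?_⟩
  have key : c * ϑ ^ 2 * wildHotCount ϑ a s Λ S C ≤ ∑ᶠ x ∈ C, cell S x := by
    rw [wildHotCount, finsum_mem_eq_finite_toFinset_sum _ hCf, finsum_mem_eq_finite_toFinset_sum _ hCf, Finset.mul_sum]
    refine Finset.sum_le_sum fun x hx => ?_
    have hxS : x ∈ S := hCS (hCf.mem_toFinset.1 hx)
    by_cases ht : ∃ (L : E3 ≃L[ℝ] E3) (w : ℤ → E3), IsEquilChart a s Λ L w ∧ IsTameStar ϑ S (LayeredHom (L : E3 →L[ℝ] E3) w) x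
    · rw [if_pos ht, mul_zero]
      exact hfloor δ hδ S hS hgood x hxS
    · rw [if_neg ht, mul_one]
      exact hgap δ hδ S hS hgood x hxS fun L w hLw htame => ht ⟨L, w, hLw, htame⟩
  exact key.trans (hbook δ hδ S hS hgood hsum C hCS hCf)

/-! ### YF-5  The column `_16XH24B` -/

/-- ★★★ **COLUMN `_16XH24B`** — `_16XH23B` with the serene leaf [SBHSᵇ](ra = 16) replaced by the COOL-MOAT DOOR [CMC] `CoolMoatCorePG (1/100) tameRadius 8 4 12 1 2
(1/16) (1/50)` (special class: isolated serene hot blobs — KILLED) and the two linked residuals [SSHSᵇ] `SlenderSereneHotSparseBPG (1/100) tameRadius 8 24 dressLevel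
dressLevel dressExponent 8 collarRadius clusterSize 4 32 8 1 2 (1/16) (1/50)` and [BSHSᵇ] `BuriedSereneHotSparseBPG (1/100) tameRadius 8 24 dressLevel dressLevel
dressExponent 8 collarRadius clusterSize 8 1 2 (1/16) (1/50)` at serenity radius `ra = 24` (`= r + rsh + q`; WEAKER than `16`, `SereneBareHotSparseBPG.of_ra_le`); [I_D],
[TBISᵇ(8)], the 20 generic leaves and `PeriodicBulkGapDoor 2` unchanged ⇒ `VisibleGap (1/50) ∧ PertRegime (1/50)`. [this file, g63] -/
theorem gap_and_pert_1_50_of_certs_16XH24B (hL : LatticeLiouvilleCert) (hL' : LayeredLiouvilleCert)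
    (hR : OscRigidityL2BDPG 1 2 (1 / 16) (1 / 16)) (hX : ExcessFlatnessControlP 1 2 (1 / 16) (1 / 16))
    (hE : ExcessChartLocalisationP 1 2 (1 / 16) (1 / 100)) (hP : RegistrationP 1 2 (1 / 16) (1 / 100))
    (hT : TailDominationCert) (hU : UniformTameStabilityE (1 / 50) 2 (1 / 2000))
    (h1 : WordTransplantP 1 2 (1 / 16) (1 / 100)) (hGT : GradReframingThickP 1 2 (1 / 16) (1 / 100) (1 / 50))
    (hΛ0 : LaunderingAprioriPX 1 2 (1 / 16) (1 / 100) (1 / 50)) (hΛs : LaunderingStepPX 1 2 (1 / 16) (1 / 100) (1 / 50))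
    (hUc : UntwistCollarP 1 2 (1 / 16) (1 / 50))
    (hl : BondIsoLevelsP 1 2 (1 / 16) (1 / 50)) (hN : EnergyNearChartPX 1 2 (1 / 16) (1 / 50) (1 / 2000))
    (hF : TailForceSlavingP 1 2 (1 / 16) (1 / 50))
    (hE' : LipDualLinearisationP 1 2 (1 / 16) (1 / 50)) (hA : L2HarmonicApproxPE 1 2 (1 / 16) (1 / 50) (1 / 2000))
    (hD : PositionDecayPLE 1 2 (1 / 16) (1 / 50) (1 / 2000)) (hC : PositionCaccioppoliPGE 1 2 (1 / 16) (1 / 50) (1 / 2000))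
    (hI : DressedCorePG tameRadius dressLevel dressLevel dressExponent 8 collarRadius clusterSize 1 2 (1 / 16) (1 / 50))
    (hCMC : CoolMoatCorePG (1 / 100) tameRadius 8 4 12 1 2 (1 / 16) (1 / 50))
    (hSSH : SlenderSereneHotSparseBPG (1 / 100) tameRadius 8 24 dressLevel dressLevel dressExponent 8 collarRadius clusterSize 4 32 8 1 2 (1 / 16) (1 / 50))
    (hBSH : BuriedSereneHotSparseBPG (1 / 100) tameRadius 8 24 dressLevel dressLevel dressExponent 8 collarRadius clusterSize 8 1 2 (1 / 16) (1 / 50))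
    (hTBIS : TameBallIncoherenceSparseBPG (1 / 100) (1 / 200) tameRadius 8 1 2 (1 / 16) (1 / 50))
    (hG : PeriodicBulkGapDoor 2) : VisibleGap (1 / 50) ∧ PertRegime (1 / 50) :=
  gap_and_pert_1_50_of_certs_16XH18B_tol hL hL' hR hX hE hP hT hU h1 hGT hΛ0 hΛs hUc (untwistBookkeepingP_one 2 (1 / 50)) hl hN hF hE' hA hD hC
    (wildFractionBPG_of_dressedCore_serene_tameBallIncoherent (by norm_num [tameRadius]) (by norm_num) (by norm_num) (by norm_num) le_rfl hI
      (sereneBareHotSparseBPG_of_coolMoat_slender_buried (by norm_num) (by norm_num) (by norm_num) (by norm_num) hCMC hSSH hBSH) hTBIS) hG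

end Summit.AtomisticToContinuum.Crystallization.Theorems.ChartedZeroExcessLayeredLatticeLiouville

end
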